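import Summits.AtomisticToContinuum.Crystallization.Theorems.HullExactificationCascadeExactHcpLocalTheoremShell
import Summits.AtomisticToContinuum.Crystallization.Theorems.DefectFreeCrystallizes.Negative.TypeGap

/-!
# Crux `HcpLandscapeGap` (stmt-AtomisticToContinuum-12087), line `birth` — stub `stub_shellGeometry`

STUB L of the skeleton `Cruxes/HcpLandscapeGap/Lines/birth.lean`: shell geometry of a
well-matched site at the enclosed relaxed hcp parameters `(a, h) = (0.97129, 0.79294) ± 10⁻⁴`.
Setting: a `δ`-separated `S ⊆ ℝ³` and `y ∈ S` that is `Good(4, θ)` — two-way `θ`-matched,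
within distance `4` of `y`, with `y + A (hcpStacking a h)`, `A` a linear isometry; we take
`θ := min (min η (δ/4)) (1/100)`.  (i) `shell_congruent`: the two partner maps are mutually
inverse bijections between the punctured `13/10·a`-shells of `y` in `S` and of the stacking at
`0` (partners are unique: `2θ < δ`, `2θ < min a h`; shell sites have norm in `[0.9710, 0.9715]`
and no site has norm in `[13/10·a, √(19/10)·a)`, so both shells stay `θ` inside the cutoff);
no counting is needed.  (ii) `not_fccType`: the nearest-neighbour distance `d` of `y` lies in
`[min a h − θ, ‖p₀‖ + θ]`, `p₀ = w + h e₃` the cap site, whose partner `z₀` lies in the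
`13/10·d`-shell; the cuboctahedron `fccKissingPattern` is centrosymmetric
(`DefectFreeCrystallizes.Negative.TypeGap.neg_mem_fccKissingPattern`), so a `1/20`-close
bijection onto it yields a shell point `t'` with `‖(z₀ − y) + (t' − y)‖ ≤ d/10` and an hcp site
`p'` with `‖p₀ + p'‖ ≤ d/10 + 2θ < 3/20` — impossible: heights force `p'` into layer `−1`, whose
lateral offset is `+w`, so second coordinates differ by `a√3/2·|j' + 2/3| > 0.28` (no antipodal
cap points, cf. `ExactHcpLocal.even_of_neg_site_mem`).  All [folklore]; tree facts:
`ExactHcpLocal.norm_site_lt_iff`, `norm_sq_of_index`, `hexagon_indices`, `cap_indices`,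
`hcp_norm_sq_eq`, `le_dist_of_mem_barlowStacking`, `hcpPeriodicConfiguration_points`.
-/

noncomputable section

namespace Summit.AtomisticToContinuum.Crystallization.Theorems.HcpLandscapeGapBirth

open Literature.MathematicalPhysics.StatisticalMechanics Literature.Geometry.DiscreteGeometry
open Summit.AtomisticToContinuum.Crystallization.Theorems.ExactHcpLocal
open Summit.AtomisticToContinuum.Crystallization.Theorems.DefectFreeCrystallizes.Negative.TypeGap

namespace ShellGeometry

/-- **Numeric envelope of the enclosure** `|a − 0.97129| ≤ 10⁻⁴`, `|h − 0.79294| ≤ 10⁻⁴`: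
linear bounds, the box envelope `64/100 a² < h² < 69/100 a²` of `ExactHcpLocal`, and the two
first-shell radii squared `a²/3 + h²`, `a²` lie in `[0.9710², 0.9715²]`. [folklore] -/
theorem envelope {a h : ℝ} (habs : |a - 97129 / 100000| ≤ 1 / 10000)
    (hhabs : |h - 79294 / 100000| ≤ 1 / 10000) :
    97119 / 100000 ≤ a ∧ a ≤ 97139 / 100000 ∧ 79284 / 100000 ≤ h ∧ h ≤ 79304 / 100000 ∧
      64 / 100 * a ^ 2 < h ^ 2 ∧ h ^ 2 < 69 / 100 * a ^ 2 ∧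
      ((9710 : ℝ) / 10000) ^ 2 ≤ a ^ 2 / 3 + h ^ 2 ∧ a ^ 2 / 3 + h ^ 2 ≤ (9715 / 10000) ^ 2 ∧
      ((9710 : ℝ) / 10000) ^ 2 ≤ a ^ 2 ∧ a ^ 2 ≤ (9715 / 10000) ^ 2 := by
  obtain ⟨h1, h2⟩ := abs_le.1 habs
  obtain ⟨h3, h4⟩ := abs_le.1 hhabs
  have haa_lo := pow_le_pow_left₀ (by norm_num) (show (97119 : ℝ) / 100000 ≤ a by linarith) 2
  have haa_hi := pow_le_pow_left₀ (by linarith) (show a ≤ 97139 / 100000 by linarith) 2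
  have hhh_lo := pow_le_pow_left₀ (by norm_num) (show (79284 : ℝ) / 100000 ≤ h by linarith) 2
  have hhh_hi := pow_le_pow_left₀ (by linarith) (show h ≤ 79304 / 100000 by linarith) 2
  norm_num at haa_lo haa_hi hhh_lo hhh_hi
  refine ⟨by linarith, by linarith, by linarith, by linarith, ?_, ?_, ?_, ?_, ?_, ?_⟩ <;>
    norm_num <;> linarith

/-- From `0 ≤ x < 13/10·a + 1/100` and `a ≥ 0.97119`: `x² < 19/10·a²`. [folklore] -/
theorem sq_lt_of_lt_cutoff {x a : ℝ} (hx : 0 ≤ x) (ha : 97119 / 100000 ≤ a)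
    (h : x < 13 / 10 * a + 1 / 100) : x ^ 2 < 19 / 10 * a ^ 2 := by
  nlinarith [mul_self_nonneg (a - 97119 / 100000), mul_self_lt_mul_self hx h]

/-- For `c ≥ 1.68` and an integer `j`: `|c/2 · (j + 2/3)| > 3/20` (as `|j + 2/3| ≥ 1/3`).
[folklore] -/
theorem lateral_far {c : ℝ} (hc : 168 / 100 ≤ c) (j : ℤ) :
    (3 : ℝ) / 20 < |c / 2 * ((j : ℝ) + 2 / 3)| := by
  rcases le_or_gt 0 j with hj | hj
  · have hj0 : (0 : ℝ) ≤ j := by exact_mod_cast hj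
    exact lt_abs.2 (Or.inl (by nlinarith [mul_nonneg (by linarith : (0 : ℝ) ≤ c) hj0]))
  · have hj1 : (j : ℝ) ≤ -1 := by exact_mod_cast (show j ≤ -1 by omega)
    exact lt_abs.2 (Or.inr (by
      nlinarith [mul_nonneg (by linarith : (0 : ℝ) ≤ c) (by linarith : (0 : ℝ) ≤ -1 - j)]))

/-- **No hcp site has norm in `[13/10·a, √(19/10)·a)`** (envelope
`64/100 a² < h² < 69/100 a²`): a site of squared norm `< 19/10·a²` lies in a layer `|k| ≤ 1`
(`4h² > 19/10·a²`), and then its in-layer form is `< 2` (hexagon layer) resp. `< 1` (cap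
layers), so it is one of the thirteen cluster sites of `norm_site_lt_iff`. [folklore] -/
theorem norm_lt_of_norm_sq_lt {a h : ℝ} (ha : 0 < a) (hh1 : 64 / 100 * a ^ 2 < h ^ 2)
    (hh2 : h ^ 2 < 69 / 100 * a ^ 2) {k i j : ℤ}
    (hlt : ‖barlowPos a h alternatingHagg k i j‖ ^ 2 < 19 / 10 * a ^ 2) :
    ‖barlowPos a h alternatingHagg k i j‖ < 13 / 10 * a := by
  rw [norm_site_lt_iff ha hh1 hh2]
  rw [hcp_norm_sq_eq] at hlt
  have ha2 : 0 < a ^ 2 := by positivity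
  have hQ : 0 ≤ (i : ℝ) ^ 2 + (i : ℝ) * j + (j : ℝ) ^ 2 +
      (haggLabel alternatingHagg k : ℝ) * ((i : ℝ) + j) +
        (haggLabel alternatingHagg k : ℝ) / 3 := by
    rcases label_eq_zero_or_one k with hL | hL <;> rw [hL]
    · nlinarith [sq_nonneg (2 * (i : ℝ) + j), sq_nonneg (j : ℝ)]
    · nlinarith [sq_nonneg (2 * (i : ℝ) + j + 1), sq_nonneg (3 * (j : ℝ) + 1)]
  have hk4 : (k : ℝ) ^ 2 < 4 := by
    by_contra hk
    have hk' : (4 : ℝ) ≤ (k : ℝ) ^ 2 := not_lt.1 hk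
    nlinarith [mul_nonneg ha2.le hQ, mul_le_mul_of_nonneg_right hk' (sq_nonneg h)]
  have hk4' : k ^ 2 < 4 := by exact_mod_cast hk4
  have hk : (k = 1 ∨ k = -1) ∨ k = 0 := by
    have : -1 ≤ k := by nlinarith
    have : k ≤ 1 := by nlinarith
    omega
  rcases hk with hk | rfl
  · have hL1 : (haggLabel alternatingHagg k : ℝ) = 1 := by
      rcases hk with rfl | rfl <;> exact_mod_cast haggLabel_alternating_of_odd (by decide)
    have hk2 : (k : ℝ) ^ 2 = 1 := by rcases hk with rfl | rfl <;> norm_num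
    rw [hL1, hk2] at hlt
    have hq : (i : ℝ) ^ 2 + i * j + (j : ℝ) ^ 2 + i + j < 1 := by nlinarith
    have hq' : i ^ 2 + i * j + j ^ 2 + i + j < 1 := by exact_mod_cast hq
    have := cap_indices hq'
    omega
  · rw [haggLabel_zero] at hlt
    push_cast at hlt
    have hq : (i : ℝ) ^ 2 + i * j + (j : ℝ) ^ 2 < 2 := by nlinarith
    have hq' : i ^ 2 + i * j + j ^ 2 < 2 := by exact_mod_cast hq
    have := hexagon_indices hq'
    omega

/-- **Norms of the twelve shell sites**: a nonzero hcp site of norm `< 13/10·a` has norm `a` or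
`√(a²/3 + h²)`, hence in `[0.9710, 0.9715]` at the enclosed parameters. [folklore] -/
theorem norm_shell_site {a h : ℝ} (habs : |a - 97129 / 100000| ≤ 1 / 10000)
    (hhabs : |h - 79294 / 100000| ≤ 1 / 10000) {p : EuclideanSpace ℝ (Fin 3)}
    (hp : p ∈ hcpStacking a h) (hp0 : p ≠ 0) (hpr : ‖p‖ < 13 / 10 * a) :
    (9710 : ℝ) / 10000 ≤ ‖p‖ ∧ ‖p‖ ≤ 9715 / 10000 := by
  obtain ⟨ha_lo, -, -, -, hh1, hh2, hc_lo, hc_hi, ha2_lo, ha2_hi⟩ := envelope habs hhabs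
  have ha0 : 0 < a := by linarith
  obtain ⟨k, i, j, rfl⟩ := hp
  have hidx := (norm_site_lt_iff ha0 hh1 hh2 k i j).1 hpr
  have hn0 := norm_nonneg (barlowPos a h alternatingHagg k i j)
  have key : ((9710 : ℝ) / 10000) ^ 2 ≤ ‖barlowPos a h alternatingHagg k i j‖ ^ 2 ∧
      ‖barlowPos a h alternatingHagg k i j‖ ^ 2 ≤ (9715 / 10000) ^ 2 := by
    rcases norm_sq_of_index (a := a) (h := h) hidx with h0 | h0 | h0
    · exact absurd (norm_eq_zero.1 ((pow_eq_zero_iff two_ne_zero).1 h0)) hp0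
    · rw [h0]; exact ⟨ha2_lo, ha2_hi⟩
    · rw [h0]; exact ⟨hc_lo, hc_hi⟩
  exact ⟨(pow_le_pow_iff_left₀ (by norm_num) hn0 two_ne_zero).1 key.1,
    (pow_le_pow_iff_left₀ hn0 (by norm_num) two_ne_zero).1 key.2⟩

/-- **`η`-congruence of the unscaled shell.** At the enclosed parameters, `0 < θ ≤ 1/100`,
`4θ ≤ δ`, `θ ≤ η`: if `S` is `δ`-separated, `y ∈ S`, and `S` is two-way `θ`-matched within
distance `4` of `y` with `y + A (hcpStacking a h)`, then the two partner maps are mutually inverse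
bijections between the punctured `13/10·a`-shell of `y` in `S` and the punctured `13/10·a`-shell
of the stacking at `0`, moving recentred points by `≤ θ ≤ η` (same isometry `A`). [folklore] -/
theorem shell_congruent {a h δ η θ : ℝ} {S : Set (EuclideanSpace ℝ (Fin 3))}
    {y : EuclideanSpace ℝ (Fin 3)} {A : EuclideanSpace ℝ (Fin 3) →ₗᵢ[ℝ] EuclideanSpace ℝ (Fin 3)}
    (habs : |a - 97129 / 100000| ≤ 1 / 10000) (hhabs : |h - 79294 / 100000| ≤ 1 / 10000)
    (hθ0 : 0 < θ) (hθδ : 4 * θ ≤ δ) (hθ1 : θ ≤ 1 / 100) (hθη : θ ≤ η)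
    (hsep : ∀ p ∈ S, ∀ q ∈ S, p ≠ q → δ ≤ dist p q) (hy : y ∈ S)
    (hA1 : ∀ p ∈ hcpStacking a h, ‖p‖ ≤ 4 → ∃ z ∈ S, dist z (y + A p) ≤ θ)
    (hA2 : ∀ z ∈ S, dist z y ≤ 4 → ∃ p ∈ hcpStacking a h, dist z (y + A p) ≤ θ) :
    ∃ A₁ : EuclideanSpace ℝ (Fin 3) →ₗᵢ[ℝ] EuclideanSpace ℝ (Fin 3),
      ∃ e : ↥{z | z ∈ S ∧ z ≠ y ∧ dist z y < 13 / 10 * a} ≃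
        ↥{p | p ∈ hcpStacking a h ∧ p ≠ 0 ∧ ‖p‖ < 13 / 10 * a},
      ∀ t : ↥{z | z ∈ S ∧ z ≠ y ∧ dist z y < 13 / 10 * a}, dist (t.1 - y) (A₁ (e t).1) ≤ η := by
  obtain ⟨ha_lo, ha_hi, hh_lo, -, hh1, hh2, -⟩ := envelope habs hhabs
  have ha0 : 0 < a := by linarith
  have hh0 : 0 < h := by linarith
  have hAdist : ∀ p, dist (y + A p) y = ‖p‖ := fun p => by
    rw [dist_eq_norm, add_sub_cancel_left, A.norm_map]
  -- the partner map `f : T → P`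
  have hf0 : ∀ t : ↥{z | z ∈ S ∧ z ≠ y ∧ dist z y < 13 / 10 * a},
      ∃ p : ↥{p | p ∈ hcpStacking a h ∧ p ≠ 0 ∧ ‖p‖ < 13 / 10 * a},
        dist t.1 (y + A p) ≤ θ := by
    intro t
    obtain ⟨htS, hty, htr⟩ := t.2
    obtain ⟨p, hp, hpt⟩ := hA2 t.1 htS (by linarith)
    have hδt : δ ≤ dist t.1 y := hsep _ htS _ hy hty
    refine ⟨⟨p, hp, ?_, ?_⟩, hpt⟩
    · rintro rfl
      rw [map_zero, add_zero] at hpt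
      linarith
    · have hn := dist_triangle (y + A p) t y
      rw [hAdist, dist_comm (y + A p) t] at hn
      obtain ⟨k, i, j, rfl⟩ := hp
      exact norm_lt_of_norm_sq_lt ha0 hh1 hh2
        (sq_lt_of_lt_cutoff (norm_nonneg _) ha_lo (by linarith))
  choose f hf using hf0
  -- the partner map `g : P → T`
  have hg0 : ∀ p : ↥{p | p ∈ hcpStacking a h ∧ p ≠ 0 ∧ ‖p‖ < 13 / 10 * a},
      ∃ t : ↥{z | z ∈ S ∧ z ≠ y ∧ dist z y < 13 / 10 * a}, dist t.1 (y + A p) ≤ θ := by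
    intro p
    obtain ⟨hp, hp0, hpr⟩ := p.2
    obtain ⟨z, hz, hzp⟩ := hA1 p.1 hp (by linarith)
    obtain ⟨hplo, hphi⟩ := norm_shell_site habs hhabs hp hp0 hpr
    have h1 : dist z y ≤ ‖p.1‖ + θ := by
      have := dist_triangle z (y + A p) y
      rw [hAdist] at this
      linarith
    have h2 : ‖p.1‖ - θ ≤ dist z y := by
      have := dist_triangle (y + A p) z y
      rw [hAdist, dist_comm (y + A p) z] at this
      linarith
    refine ⟨⟨z, hz, ?_, ?_⟩, hzp⟩
    · intro hzy; rw [hzy, dist_self] at h2; linarith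
    · show dist z y < 13 / 10 * a
      linarith
  choose g hg using hg0
  -- mutually inverse, by uniqueness of partners
  have hgf : ∀ t, g (f t) = t := fun t => by
    apply Subtype.ext
    by_contra hne
    have h1 := hsep _ (g (f t)).2.1 _ t.2.1 hne
    have h2 : dist (g (f t)).1 t ≤ θ + θ :=
      (dist_triangle _ (y + A (f t)) _).trans
        (add_le_add (hg (f t)) (by rw [dist_comm]; exact hf t))
    linarith
  have hfg : ∀ p, f (g p) = p := fun p => by
    apply Subtype.ext
    by_contra hne
    have h1 := le_dist_of_mem_barlowStacking a h alternatingHagg ha0.le hh0.le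
      (f (g p)).2.1 p.2.1 hne
    have h2 : dist (f (g p)).1 p ≤ θ + θ := by
      rw [← A.dist_map, ← dist_add_left y]
      exact (dist_triangle _ (g p).1 _).trans
        (add_le_add (by rw [dist_comm]; exact hf (g p)) (hg p))
    have h3 : min a h ≤ h := min_le_right _ _
    have h4 : min a h ≤ a := min_le_left _ _
    rcases min_choice a h with hm | hm <;> linarith
  refine ⟨A, ⟨f, g, hgf, hfg⟩, fun t => ?_⟩
  show dist (t.1 - y) (A (f t)) ≤ η
  rw [dist_eq_norm, sub_sub, ← dist_eq_norm]
  exact (hf t).trans hθη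

/-- **A well-matched site is not fcc-type.** At the enclosed parameters, `0 < θ ≤ 1/100`,
`4θ ≤ δ`: if `S` is `δ`-separated, `y ∈ S`, and `S` is two-way `θ`-matched within distance `4`
of `y` with `y + A (hcpStacking a h)`, then the first shell of `y` (cutoff `13/10·d`, `d` the
nearest-neighbour distance of `y`), rescaled by `d⁻¹`, is not `1/20`-close to
`fccKissingPattern` under any linear isometry and bijection: the cuboctahedron is
centrosymmetric, while the partner of the cap site `w + h e₃` has no approximate antipode
(`‖(w + h e₃) + p'‖ > 3/20` for every hcp site `p'`). [folklore] -/
theorem not_fccType {a h δ θ : ℝ} {S : Set (EuclideanSpace ℝ (Fin 3))}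
    {y : EuclideanSpace ℝ (Fin 3)} {A : EuclideanSpace ℝ (Fin 3) →ₗᵢ[ℝ] EuclideanSpace ℝ (Fin 3)}
    (habs : |a - 97129 / 100000| ≤ 1 / 10000) (hhabs : |h - 79294 / 100000| ≤ 1 / 10000)
    (hθ0 : 0 < θ) (hθδ : 4 * θ ≤ δ) (hθ1 : θ ≤ 1 / 100)
    (hsep : ∀ p ∈ S, ∀ q ∈ S, p ≠ q → δ ≤ dist p q) (hy : y ∈ S)
    (hA1 : ∀ p ∈ hcpStacking a h, ‖p‖ ≤ 4 → ∃ z ∈ S, dist z (y + A p) ≤ θ)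
    (hA2 : ∀ z ∈ S, dist z y ≤ 4 → ∃ p ∈ hcpStacking a h, dist z (y + A p) ≤ θ) :
    ¬ ∃ A' : EuclideanSpace ℝ (Fin 3) →ₗᵢ[ℝ] EuclideanSpace ℝ (Fin 3),
      ∃ e : ↥{z | z ∈ S ∧ z ≠ y ∧
          dist z y < 13 / 10 * sInf ((fun z => dist z y) '' (S \ {y}))} ≃ ↥fccKissingPattern,
        ∀ t : ↥{z | z ∈ S ∧ z ≠ y ∧ dist z y < 13 / 10 * sInf ((fun z => dist z y) '' (S \ {y}))},
          dist ((sInf ((fun z => dist z y) '' (S \ {y})))⁻¹ • (t.1 - y)) (A' (e t).1) ≤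
            1 / 20 := by
  obtain ⟨ha_lo, ha_hi, hh_lo, -, hh1, hh2, hc_lo, hc_hi, -⟩ := envelope habs hhabs
  have ha0 : 0 < a := by linarith
  have hh0 : 0 < h := by linarith
  have hmin : (79284 : ℝ) / 100000 ≤ min a h := le_min (by linarith) hh_lo
  have hAdist : ∀ p, dist (y + A p) y = ‖p‖ := fun p => by
    rw [dist_eq_norm, add_sub_cancel_left, A.norm_map]
  have hzero : 0 ∈ hcpStacking a h := ⟨0, 0, 0, (barlowPos_alternating_zero a h).symm⟩
  set d : ℝ := sInf ((fun z => dist z y) '' (S \ {y})) with hd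
  rintro ⟨A', e', hA'⟩
  -- the cap site `p₀ = w + h e₃` and its partner `z₀`
  set p₀ := barlowPos a h alternatingHagg 1 0 0 with hp₀
  have hp₀sq : ‖p₀‖ ^ 2 = a ^ 2 / 3 + h ^ 2 := by
    rw [hp₀, hcp_norm_sq_eq, haggLabel_alternating_of_odd odd_one]
    push_cast
    ring
  have hp₀n := norm_nonneg p₀
  have hp₀hi : ‖p₀‖ ≤ 9715 / 10000 :=
    (pow_le_pow_iff_left₀ hp₀n (by norm_num) two_ne_zero).1 (hp₀sq ▸ hc_hi)
  have hp₀lo : (9710 : ℝ) / 10000 ≤ ‖p₀‖ :=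
    (pow_le_pow_iff_left₀ (by norm_num) hp₀n two_ne_zero).1 (hp₀sq ▸ hc_lo)
  obtain ⟨z₀, hz₀S, hz₀⟩ := hA1 p₀ (barlowPos_mem 1 0 0) (by linarith)
  have hz₀hi : dist z₀ y ≤ ‖p₀‖ + θ := by
    have := dist_triangle z₀ (y + A p₀) y
    rw [hAdist] at this
    linarith
  have hz₀lo : ‖p₀‖ - θ ≤ dist z₀ y := by
    have := dist_triangle (y + A p₀) z₀ y
    rw [hAdist, dist_comm (y + A p₀) z₀] at this
    linarith
  have hz₀y : z₀ ≠ y := fun h0 => by rw [h0, dist_self] at hz₀lo; linarith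
  have hz₀mem : z₀ ∈ S \ {y} := ⟨hz₀S, by rwa [Set.mem_singleton_iff]⟩
  -- `min a h - θ ≤ d ≤ ‖p₀‖ + θ`
  have hbdd : BddBelow ((fun z => dist z y) '' (S \ {y})) :=
    ⟨0, by rintro _ ⟨z, -, rfl⟩; exact dist_nonneg⟩
  have hd_hi : d ≤ ‖p₀‖ + θ := (csInf_le hbdd ⟨z₀, hz₀mem, rfl⟩).trans hz₀hi
  have hlow : ∀ z ∈ S \ {y}, min a h - θ ≤ dist z y := by
    rintro z ⟨hzS, hzy⟩
    rw [Set.mem_singleton_iff] at hzy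
    by_cases hz4 : dist z y ≤ 4
    · obtain ⟨p, hp, hzp⟩ := hA2 z hzS hz4
      by_cases hp0 : p = 0
      · rw [hp0, map_zero, add_zero] at hzp
        linarith [hsep z hzS y hy hzy]
      · have h1 :=
          le_dist_of_mem_barlowStacking a h alternatingHagg ha0.le hh0.le hp hzero hp0
        rw [dist_zero_right] at h1
        have := dist_triangle (y + A p) z y
        rw [hAdist, dist_comm (y + A p) z] at this
        linarith
    · linarith [min_le_left a h, not_le.1 hz4]
  have hd_lo : min a h - θ ≤ d :=
    le_csInf ⟨_, z₀, hz₀mem, rfl⟩ (by rintro _ ⟨z, hz, rfl⟩; exact hlow z hz)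
  have hd0 : 0 < d := by linarith
  -- `z₀` lies in the rescaled shell; its antipode under the cuboctahedral bijection
  obtain ⟨t, ht⟩ : ∃ t : ↥{z | z ∈ S ∧ z ≠ y ∧ dist z y < 13 / 10 * d}, t.1 = z₀ :=
    ⟨⟨z₀, hz₀S, hz₀y, by linarith⟩, rfl⟩
  obtain ⟨t', ht'⟩ := e'.surjective ⟨-(e' t).1, neg_mem_fccKissingPattern (e' t).2⟩
  have ht'E : (e' t').1 = -(e' t).1 := by rw [ht']
  have h1 := hA' t
  have h2 := hA' t'
  rw [ht'E, map_neg, dist_eq_norm, sub_neg_eq_add] at h2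
  rw [dist_eq_norm] at h1
  have hsum : ‖(t.1 - y) + (t'.1 - y)‖ ≤ d / 10 := by
    have h3 := norm_add_le_of_le h1 h2
    rw [sub_add_add_cancel, ← smul_add, norm_smul, norm_inv, Real.norm_of_nonneg hd0.le,
      inv_mul_le_iff₀ hd0] at h3
    linarith
  -- the partner `p'` of `t'`
  obtain ⟨ht'S, -, ht'r⟩ := t'.2
  obtain ⟨p', hp', ht'p'⟩ := hA2 _ ht'S (by linarith)
  have hsmall : ‖p₀ + p'‖ < 3 / 20 := by
    have e1 : ‖p₀ + p'‖ = ‖A p₀ + A p'‖ := by rw [← map_add, A.norm_map]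
    have e2 : A p₀ + A p' =
        ((t.1 - y) + (t'.1 - y)) - ((t.1 - y) - A p₀) - ((t'.1 - y) - A p') := by abel
    have h3 : ‖(t.1 - y) - A p₀‖ ≤ θ := by rw [sub_sub, ← dist_eq_norm, ht]; exact hz₀
    have h4 : ‖(t'.1 - y) - A p'‖ ≤ θ := by rw [sub_sub, ← dist_eq_norm]; exact ht'p'
    have h5 := norm_sub_le_of_le (norm_sub_le_of_le hsum h3) h4
    rw [← e2, ← e1] at h5
    linarith
  -- contradiction: `-p₀` is far from the stacking (heights, then the lateral offset)
  obtain ⟨k', i', j', rfl⟩ := hp'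
  have hc2 : |(p₀ + barlowPos a h alternatingHagg k' i' j') 2| < 3 / 20 :=
    lt_of_le_of_lt (by simpa only [Real.norm_eq_abs] using
      PiLp.norm_apply_le (p₀ + barlowPos a h alternatingHagg k' i' j') 2) hsmall
  have hco2 : (p₀ + barlowPos a h alternatingHagg k' i' j') 2 = (1 + (k' : ℝ)) * h := by
    rw [PiLp.add_apply, hp₀, barlowPos_apply_two, barlowPos_apply_two]
    push_cast
    ring
  rw [hco2, abs_mul, abs_of_pos hh0] at hc2
  have hk' : k' = -1 := by
    by_contra hne
    have h5 : (1 : ℝ) ≤ |(1 : ℝ) + k'| := by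
      have : (1 : ℤ) ≤ |1 + k'| := Int.one_le_abs (by omega)
      exact_mod_cast this
    linarith [le_mul_of_one_le_left hh0.le h5]
  subst hk'
  have hc1 : |(p₀ + barlowPos a h alternatingHagg (-1) i' j') 1| < 3 / 20 :=
    lt_of_le_of_lt (by simpa only [Real.norm_eq_abs] using
      PiLp.norm_apply_le (p₀ + barlowPos a h alternatingHagg (-1) i' j') 1) hsmall
  have hco1 : (p₀ + barlowPos a h alternatingHagg (-1) i' j') 1 =
      a * Real.sqrt 3 / 2 * ((j' : ℝ) + 2 / 3) := by
    rw [PiLp.add_apply, hp₀, barlowPos_apply_one, barlowPos_apply_one,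
      haggLabel_alternating_of_odd odd_one, haggLabel_alternating_of_odd (by decide)]
    push_cast
    ring
  rw [hco1] at hc1
  have h3 : (1732 : ℝ) / 1000 < Real.sqrt 3 := (Real.lt_sqrt (by norm_num)).2 (by norm_num)
  have hc : (168 : ℝ) / 100 ≤ a * Real.sqrt 3 := by
    linarith [mul_le_mul ha_lo h3.le (by norm_num) ha0.le]
  exact absurd hc1 (not_lt.2 (lateral_far hc j').le)

end ShellGeometry

/-- **Stub L (`stub_shellGeometry`) of the line skeleton `Cruxes/HcpLandscapeGap/Lines/birth.lean`**
(registered signature, verbatim).  At the enclosed relaxed hcp parameters, for all `δ, η > 0`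
there is `θ > 0` (namely `min (min η (δ/4)) (1/100)`) such that for every `δ`-separated
`S ⊆ ℝ³` and every `y ∈ S` two-way `θ`-matched within distance `4` with
`y + A (hcpStacking a h)`, `A` a linear isometry: (i) the punctured `13/10·a`-shell of `y` is
`η`-congruent to that of the stacking at `0` (`ShellGeometry.shell_congruent`); (ii) the first
shell of `y`, rescaled by the nearest-neighbour distance, is not `1/20`-close to the
cuboctahedron `fccKissingPattern` (`ShellGeometry.not_fccType`). [folklore] -/
theorem stub_shellGeometry : ∀ a h : ℝ, ∀ ha : a ≠ 0, ∀ hh : h ≠ 0, |a - 97129 / 100000| ≤ 1 / 10000 → |h - 79294 / 100000| ≤ 1 / 10000 → ∀ δ : ℝ, 0 < δ → ∀ η : ℝ, 0 < η → ∃ θ : ℝ, 0 < θ ∧ ∀ S : Set (EuclideanSpace ℝ (Fin 3)), (∀ y ∈ S, ∀ z ∈ S, y ≠ z → δ ≤ dist y z) → ∀ y ∈ S, (∃ A : EuclideanSpace ℝ (Fin 3) →ₗᵢ[ℝ] EuclideanSpace ℝ (Fin 3), (∀ p ∈ (Literature.MathematicalPhysics.StatisticalMechanics.hcpPeriodicConfiguration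 ha hh).points, ‖p‖ ≤ 4 → ∃ z ∈ S, dist z (y + A p) ≤ θ) ∧ (∀ z ∈ S, dist z y ≤ 4 → ∃ p ∈ (Literature.MathematicalPhysics.StatisticalMechanics.hcpPeriodicConfiguration ha hh).points, dist z (y + A p) ≤ θ)) → (let T : Set (EuclideanSpace ℝ (Fin 3)) := {z : EuclideanSpace ℝ (Fin 3) | z ∈ S ∧ z ≠ y ∧ dist z y < 13 / 10 * a}; let P : Set (EuclideanSpace ℝ (Fin 3)) := {p : EuclideanSpace ℝ (Fin 3) | p ∈ Literature.MathematicalPhysics.StatisticalMechanics.hcpStacking a h ∧ p ≠ 0 ∧ ‖p‖ < 13 / 10 * a}; ∃ A : EuclideanSpace ℝ (Fin 3) →ₗᵢ[ℝ] EuclideanSpace ℝ (Fin 3), ∃ e : ↥T ≃ ↥P, ∀ t : ↥T, dist ((t : EuclideanSpace ℝ (Fin 3)) - y) (A ((e t : ↥P) : EuclideanSpace ℝ (Fin 3))) ≤ η) ∧ ¬ (let d : ℝ := sInf ((fun z => dist z y) '' (S \ {y})); let T : Set (EuclideanSpace ℝ (Fin 3)) := {z : EuclideanSpace ℝ (Fin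 3) | z ∈ S ∧ z ≠ y ∧ dist z y < 13 / 10 * d}; ∃ A : EuclideanSpace ℝ (Fin 3) →ₗᵢ[ℝ] EuclideanSpace ℝ (Fin 3), ∃ e : ↥T ≃ ↥Literature.Geometry.DiscreteGeometry.fccKissingPattern, ∀ t : ↥T, dist (d⁻¹ • ((t : EuclideanSpace ℝ (Fin 3)) - y)) (A ((e t : ↥Literature.Geometry.DiscreteGeometry.fccKissingPattern) : EuclideanSpace ℝ (Fin 3))) ≤ 1 / 20) := by
  intro a h ha hh habs hhabs δ hδ η hη
  refine ⟨min (min η (δ / 4)) (1 / 100), lt_min (lt_min hη (by linarith)) (by norm_num), ?_⟩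
  intro S hsep y hy hgood
  obtain ⟨A, hA1, hA2⟩ := hgood
  rw [hcpPeriodicConfiguration_points ha hh] at hA1 hA2
  have hθη : min (min η (δ / 4)) (1 / 100) ≤ η := (min_le_left _ _).trans (min_le_left _ _)
  have hθ4 : min (min η (δ / 4)) (1 / 100) ≤ δ / 4 := (min_le_left _ _).trans (min_le_right _ _)
  have hθδ : 4 * min (min η (δ / 4)) (1 / 100) ≤ δ := by linarith
  have hθ1 : min (min η (δ / 4)) (1 / 100) ≤ 1 / 100 := min_le_right _ _
  have hθ0 : 0 < min (min η (δ / 4)) (1 / 100) := lt_min (lt_min hη (by linarith)) (by norm_num)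
  dsimp only
  exact ⟨ShellGeometry.shell_congruent habs hhabs hθ0 hθδ hθ1 hθη hsep hy hA1 hA2,
    ShellGeometry.not_fccType habs hhabs hθ0 hθδ hθ1 hsep hy hA1 hA2⟩

end Summit.AtomisticToContinuum.Crystallization.Theorems.HcpLandscapeGapBirth

end
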